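import Summits.BirchSwinnertonDyer.Rank1Residual.WAll.Target
import Summits.BirchSwinnertonDyer.Rank1Residual.X10.ClassX10bLeaf
import Summits.BirchSwinnertonDyer.Rank1Residual.Partition.CornersCM
import HarnessLib

/-!
# The cell's SECOND leaf: W-ALL/10b corner `WAllCornerX10b` versus the leaf `X10.BSDpOnClassX10b`
# (corner ⟹ leaf bridge through the CM closers; cell `bsd-print-x9`, seat p2; ty2's note 2026-08-27T14:48:56Z)

HONEST FRAMING. The W-ALL/10b corner `Summit.BirchSwinnertonDyer.WAllCornerX10b` (`WAll/Target.lean`: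
`¬ W.HasCM → ClassX10 W p → ¬ Surj W p → W.analyticRank ≤ 1 → BSDp W p`) carries the binder `¬ W.HasCM`,
while the cell's second leaf `Summit.BirchSwinnertonDyer.Rank1Residual.X10.BSDpOnClassX10b`
(`X10/ClassX10bLeaf.lean`: `ClassX10 W p → ¬ Surj W 3 → BSDp W p`) does not — and CM curves DO satisfy
`ClassX10 ∧ ¬Surj(3)` (`p = 3` split in the CM field, `j ∈ {8000, −32768}`, image in a Cartan normaliser,
`E[3]` irreducible). The tree has leaf ⟹ corner (`WAll.wallCornerX10b_of_bsdpOnClassX10b`) but not corner ⟹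
leaf (ty2's turnkey note, STATUS 14:48:56Z). This file supplies corner ⟹ leaf: the CM pairs of the leaf are
closed by the tree's CM closers at an odd GOOD prime (`Rank1Residual.bsdp_cm_of_good_of_ne_two`:
rank `0` ⇒ row C8 — Rubin 1991 / Burungale–Flach 2024 via the CM triple `hCM` + modularity `hmod`;
rank `1`, split ⇒ row C17 — Li–Liu–Tian 2024 Thm 1.1 `hLLT`; rank `1`, good ⇒ row C10 — Kobayashi 2013
Cor 1.4 `hKob`), and `ClassX10 W p` pins `p = 3` (good ordinary, rank `≤ 1`), so the non-CM pairs are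
exactly the corner. Hence, granted those four PUBLISHED CM binders (the same ones
`Partition/CornersAll.lean` carries), corner and leaf are EQUIVALENT; a future PrintX10b route may
close either. Theorems only; nothing asserted; no new definition, no named fact.
beyond-print theorem: no (bookkeeping).
-/

noncomputable section

open scoped Classical

open WeierstrassCurve Literature.NumberTheory.EllipticCurves
  Literature.NumberTheory.EllipticCurves.Rank1Residual

set_option autoImplicit false

namespace Summit.BirchSwinnertonDyer.Rank1Residual.X10

open Summit.BirchSwinnertonDyer (WAllCornerX10b)

/-- **Corner W-ALL/10b ⟹ leaf `X10.BSDpOnClassX10b`.** Granted the CM rows' published binders — the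
CM triple `hCM` (Rubin 1991 / Burungale–Flach 2024), modularity `hmod`, Li–Liu–Tian 2024 Thm 1.1
`hLLT`, Kobayashi 2013 Cor 1.4 `hKob` — the corner `WAllCornerX10b` (non-CM X10b pairs) gives the
leaf: a CM pair with `ClassX10 W p` has `p = 3` GOOD (ordinary) and analytic rank `≤ 1`, so
`bsdp_cm_of_good_of_ne_two` closes it; a non-CM pair is the corner's own statement. [folklore] -/
theorem bsdpOnClassX10b_of_wallCornerX10b (hCM : bsdTriple_of_hasCM_of_L_one_ne_zero)
    (hmod : hasEntireLFunction_rat) (hLLT : LiLiuTian2024.thm11_bsdp_of_cm_rank_one)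
    (hKob : Kobayashi2013.cor14_bsdp_of_cm_rank_one) (h : WAllCornerX10b) :
    BSDpOnClassX10b := by
  intro W _ _ p _ hX hns
  obtain ⟨hp3, hord, -, hrk⟩ := id hX
  have hr : W.analyticRank ≤ 1 := by
    rcases hrk with ⟨h0, -⟩ | ⟨h1, -⟩ <;> omega
  by_cases hcm : W.HasCM
  · subst hp3
    exact bsdp_cm_of_good_of_ne_two hCM hmod hLLT hKob hcm hr (by decide) hord.1
  · subst hp3
    exact h W 3 hcm hX hns hr

/-- **Corner ⟺ leaf for X10b**, granted the four CM binders (converse = the landed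
`WAll.wallCornerX10b_of_bsdpOnClassX10b` / `X10.bsdp_of_bsdpOnClassX10b`). [folklore] -/
theorem wallCornerX10b_iff_bsdpOnClassX10b (hCM : bsdTriple_of_hasCM_of_L_one_ne_zero)
    (hmod : hasEntireLFunction_rat) (hLLT : LiLiuTian2024.thm11_bsdp_of_cm_rank_one)
    (hKob : Kobayashi2013.cor14_bsdp_of_cm_rank_one) :
    WAllCornerX10b ↔ BSDpOnClassX10b := by
  refine ⟨bsdpOnClassX10b_of_wallCornerX10b hCM hmod hLLT hKob, fun h W _ _ p _ _ hX hns _ ↦ ?_⟩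
  obtain ⟨hp3, -⟩ := id hX
  subst hp3
  exact h W 3 hX hns

end Summit.BirchSwinnertonDyer.Rank1Residual.X10
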